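import Summits.MatrixMultiplication.MatrixMultiplication.Theorems.FarEdgeDescentLogRateSharp

/-!
# FarEdgeDescent — far-edge rigidity of the Coppersmith–Winograd powers (decomp-mm lens 2, gen 15)

Kernel lemmas behind the gen-15 node (`NODE-v15.md`, census ask I9′ decided): for the laser method run on ANY fixed
power `CW_q^{⊗m}` with independent (variable-disjoint) block products — the class of every published square or
rectangular CW analysis — the far-edge constant of `ω(1,1,k) − (k+1) ≲ c/log k` is the first-power constant

  `c₁ = (3/2)·log 3 − 2·log 2 = log(3√3/4) = 0.2616…`   for every `m ≥ 1`.

Three ingredients are certified here, sorry-free: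

* `## FarEdgeGas` — the dilute first-power functional `cwGas c t` and its lower envelope `cwGasEnvelope t`
  (`= min_c cwGas c t`), with the strip minimum `cwFarEdgeConstant_le_cwGas : ∀ c>0, ∀ t∈[0,½], c₁ ≤ cwGas c t`
  (ported from the seat's v4 draft; the landed `FarEdgeDescentLogRateSharp` proves the rung `LogRateSharp` by a different,
  integer-certificate route and does not contain the envelope).
* `## CoupledGas` — the power-`m` kernel inequality.  After the zero-price classification (next item) the power-`m`
  far-edge programme reduces to `F_m = [N(w,h) + (1+h)·log m − Γ_B − h·γ_C]/(1+h)` with the per-block caps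
  `Γ_B ≤ log m`, `γ_C ≤ log m`, where `N = cwGasCouple w h := (1+2w+h)·log(2/(1+2w+h)) + (1+w+h)·log(1+w+h) + w·log w`
  (`w ∈ [0,½]` the scalar/`A^±` rate below the X/Y balance, `h ≥ 0` the relative mass of the type `C = (2,m−1,m−1)`);
  `cwFarEdgeConstant_mul_le_cwGasCouple : c₁·(1+h) ≤ cwGasCouple w h` is then exactly `F_m ≥ c₁`.
  Proof: `∂_h N = log(2(1+w+h)/(1+2w+h)) ≥ log(3/2)` iff `1 + h ≥ 2w`; `N(w,0) = cwGasEnvelope w ≥ c₁`; and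
  `log(3/2) − c₁ = ½·log(4/3) > 0` (`log_three_halves_sub_cwFarEdgeConstant`).
* `## ZeroPrice` — the arithmetic of the survivor classification: with the folded level `λ(U) = min U (2m−U)` and the
  leading-order price `m − λ(U) − [U ≠ m]`, a level has price zero iff `U ∈ {m−1, m, m+1}`, and the level triples
  `(I,J,K)`, `I+J+K = 2m`, whose `J`- and `K`-prices vanish are exactly the six types
  bulk `(0,m,m)`, `A± = (0,m∓1,m±1)`, `B = (1,m−1,m)`, `B′ = (1,m,m−1)`, `C = (2,m−1,m−1)` (`zeroPrice_classification`).

Informal companion (not formalised): the count/volume bookkeeping that turns these three facts into `c_m = c₁`, and the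
X-star loophole analysis (asymmetric hashing realises x-shared stars past the X/Y balance, whose Y-count functional is
`cwGasEnvelope t` for `t > ½` with `inf = 0` (`cwGasEnvelope` is `Θ(1/t)`); their leaves have random, mutually
incoherent matrix formats, and any value loss `d^{−κ}`, `κ > 0`, pins the optimum back at `t = ½`, i.e. at `c₁`) are in
`NODE-v15.md` §2–§3 of the seat folder.  Intended use: `--supports stmt-MatrixMultiplication-25371` (aside `SubLogRate`)
/ the rate side of `PowerAmortisation` (25347).
-/

set_option linter.dupNamespace false

noncomputable section

namespace Summit.MatrixMultiplication.MatrixMultiplication.Theorems.FarEdgeDescentFarEdgeRigidity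

open Summit.MatrixMultiplication.MatrixMultiplication.Theorems.FarEdgeDescentLogRateSharp
  (cwFarEdgeConstant_eq_log cwFarEdgeConstant_pos cwFarEdgeConstant_lt_log_two)

/-! ## FarEdgeGas — the dilute first-power functional and its envelope -/

/-- The far-edge constant `c₁ = (3/2)·log 3 − 2·log 2 = log(3√3/4) = 0.26162…`. -/
def cwFarEdgeConstant : ℝ := 3 / 2 * Real.log 3 - 2 * Real.log 2

/-- Unfolding lemma: `c₁` is the explicit constant of the landed `FarEdgeDescentLogRateSharp` lemmas. -/
theorem cwFarEdgeConstant_def : cwFarEdgeConstant = 3 / 2 * Real.log 3 - 2 * Real.log 2 := rfl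

/-- `0 < c₁` (landed `cwFarEdgeConstant_pos`, restated for the local abbreviation). -/
theorem cwFarEdgeConstant_pos' : 0 < cwFarEdgeConstant := cwFarEdgeConstant_pos

/-- `c₁ < log 2` (landed `cwFarEdgeConstant_lt_log_two`, restated for the local abbreviation). -/
theorem cwFarEdgeConstant_lt_log_two' : cwFarEdgeConstant < Real.log 2 := cwFarEdgeConstant_lt_log_two

/-- `log(3/2) − c₁ = ½·log(4/3)`: the `h`-slope of the coupled functional beats the constant. -/
theorem log_three_halves_sub_cwFarEdgeConstant :
    Real.log (3 / 2) - cwFarEdgeConstant = 1 / 2 * Real.log (4 / 3) := by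
  unfold cwFarEdgeConstant
  rw [Real.log_div (by norm_num) (by norm_num), Real.log_div (by norm_num) (by norm_num),
    show (4 : ℝ) = 2 ^ 2 by norm_num, Real.log_pow]
  push_cast
  ring

/-- `c₁ < log(3/2)`. -/
theorem cwFarEdgeConstant_lt_log_three_halves : cwFarEdgeConstant < Real.log (3 / 2) := by
  have h : 0 < 1 / 2 * Real.log (4 / 3) := by
    have : 0 < Real.log (4 / 3) := Real.log_pos (by norm_num)
    linarith
  linarith [log_three_halves_sub_cwFarEdgeConstant]

/-- The dilute first-power far-edge functional (`c = q·β`, `t = σ/β`; count taken on the binding Y side, `t ≤ ½`):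
`G(c,t) = 2/c + (1+2t)(log c − 1) + (1+t) log(1+t) + t log t`; `e₁(k)·log k → min G = G(1, ½) = c₁`. -/
def cwGas (c t : ℝ) : ℝ :=
  2 / c + (1 + 2 * t) * (Real.log c - 1) + (1 + t) * Real.log (1 + t) + t * Real.log t

/-- The minimum value: `G(1, 1/2) = c₁`. -/
theorem cwGas_one_half : cwGas 1 (1 / 2) = cwFarEdgeConstant := by
  unfold cwGas cwFarEdgeConstant
  rw [Real.log_one, show (1 : ℝ) + 1 / 2 = 3 / 2 by norm_num,
    Real.log_div (by norm_num) (by norm_num), show ((1 : ℝ) / 2) = (2 : ℝ)⁻¹ by norm_num,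
    Real.log_inv]
  ring

/-- `G(c,½) − G(1,½) = 2/c + 2 log c − 2`. -/
theorem cwGas_half_sub (c : ℝ) : cwGas c (1 / 2) - cwGas 1 (1 / 2) = 2 / c + 2 * Real.log c - 2 := by
  unfold cwGas
  rw [Real.log_one]
  ring

/-- At the balanced scalar rate `t = 1/2` the functional is minimised at `c = 1` (`q ∼ k`):
`G(c, 1/2) ≥ c₁` for every `c > 0` (`log c ≥ 1 − 1/c`). -/
theorem cwGas_half_ge {c : ℝ} (hc : 0 < c) : cwFarEdgeConstant ≤ cwGas c (1 / 2) := by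
  have h := Real.one_sub_inv_le_log_of_pos hc
  have hd := cwGas_half_sub c
  rw [cwGas_one_half] at hd
  have e : 2 / c = 2 * c⁻¹ := div_eq_mul_inv 2 c
  linarith

/-- Lower envelope of the gas over `c` (attained at `c = 2/(1+2t)`):
`m(t) = (1+2t)(log 2 − log(1+2t)) + (1+t)log(1+t) + t log t = ½[ψ(2+2t) + ψ(2t)] − ψ(1+2t)`, `ψ(x) = x log x`.
For `t > ½` the same expression is the Y-count functional of the x-shared star configuration (NODE-v15 §3). -/
def cwGasEnvelope (t : ℝ) : ℝ :=
  (1 + 2 * t) * (Real.log 2 - Real.log (1 + 2 * t)) + (1 + t) * Real.log (1 + t) + t * Real.log t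

/-- `m(½) = c₁`. -/
theorem cwGasEnvelope_half : cwGasEnvelope (1 / 2) = cwFarEdgeConstant := by
  unfold cwGasEnvelope cwFarEdgeConstant
  rw [show (1 : ℝ) + 2 * (1 / 2) = 2 by norm_num, show (1 : ℝ) + 1 / 2 = 3 / 2 by norm_num,
    Real.log_div (by norm_num) (by norm_num), show ((1 : ℝ) / 2) = (2 : ℝ)⁻¹ by norm_num, Real.log_inv]
  ring

/-- The scalar-free design (`t = 0`; also the «zone» construction of NODE-v15 §3.4) has constant `log 2`. -/
theorem cwGasEnvelope_zero : cwGasEnvelope 0 = Real.log 2 := by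
  unfold cwGasEnvelope
  simp

/-- `G(c,t) ≥ m(t)` for all `c > 0` (`1/u + log u ≥ 1` at `u = c(1+2t)/2`). -/
theorem cwGasEnvelope_le_cwGas {c t : ℝ} (hc : 0 < c) (ht : 0 ≤ t) : cwGasEnvelope t ≤ cwGas c t := by
  have h12 : 0 < 1 + 2 * t := by linarith
  have hc' := hc.ne'
  have h12' := h12.ne'
  obtain ⟨u, hu⟩ : ∃ u : ℝ, u = c * (1 + 2 * t) / 2 := ⟨_, rfl⟩
  have hu0 : 0 < u := by rw [hu]; positivity
  have hlogu : Real.log u = Real.log c + Real.log (1 + 2 * t) - Real.log 2 := by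
    rw [hu, Real.log_div (by positivity) two_ne_zero, Real.log_mul hc' h12']
  have key := Real.one_sub_inv_le_log_of_pos hu0
  have e2 : 2 / c = (1 + 2 * t) * u⁻¹ := by
    rw [hu]
    field_simp
  have hdiff : cwGas c t - cwGasEnvelope t = (1 + 2 * t) * (u⁻¹ + Real.log u - 1) := by
    unfold cwGas cwGasEnvelope
    rw [hlogu, e2]
    ring
  have hnn : 0 ≤ (1 + 2 * t) * (u⁻¹ + Real.log u - 1) := mul_nonneg h12.le (by linarith)
  linarith

/-- `m′(t) = 2 log 2 − 2 log(1+2t) + log(1+t) + log t` for `t > 0`. -/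
theorem cwGasEnvelope_hasDerivAt {t : ℝ} (ht : 0 < t) :
    HasDerivAt cwGasEnvelope
      (2 * Real.log 2 - 2 * Real.log (1 + 2 * t) + Real.log (1 + t) + Real.log t) t := by
  have h12 : 0 < 1 + 2 * t := by linarith
  have h1 : 0 < 1 + t := by linarith
  have hA : HasDerivAt (fun t : ℝ => 1 + 2 * t) 2 t := by
    simpa using ((hasDerivAt_id t).const_mul (2 : ℝ)).const_add (1 : ℝ)
  have hB : HasDerivAt (fun t : ℝ => Real.log (1 + 2 * t)) (2 / (1 + 2 * t)) t := hA.log h12.ne'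
  have hC : HasDerivAt (fun t : ℝ => (1 + 2 * t) * (Real.log 2 - Real.log (1 + 2 * t)))
      (2 * (Real.log 2 - Real.log (1 + 2 * t)) + (1 + 2 * t) * (0 - 2 / (1 + 2 * t))) t :=
    hA.mul ((hasDerivAt_const t (Real.log 2)).sub hB)
  have hS : HasDerivAt (fun t : ℝ => 1 + t) 1 t := by
    simpa using (hasDerivAt_id t).const_add (1 : ℝ)
  have hD : HasDerivAt (fun t : ℝ => (1 + t) * Real.log (1 + t)) ((Real.log (1 + t) + 1) * 1) t :=
    (Real.hasDerivAt_mul_log h1.ne').comp t hS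
  have hE : HasDerivAt (fun t : ℝ => t * Real.log t) (Real.log t + 1) t := Real.hasDerivAt_mul_log ht.ne'
  have hsum := (hC.add hD).add hE
  have e3 : (1 + 2 * t) * (2 / (1 + 2 * t)) = 2 := by field_simp
  have e : 2 * (Real.log 2 - Real.log (1 + 2 * t)) + (1 + 2 * t) * (0 - 2 / (1 + 2 * t)) +
      (Real.log (1 + t) + 1) * 1 + (Real.log t + 1) =
      2 * Real.log 2 - 2 * Real.log (1 + 2 * t) + Real.log (1 + t) + Real.log t := by
    have : (1 + 2 * t) * (0 - 2 / (1 + 2 * t)) = -2 := by rw [zero_sub, mul_neg, e3]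
    rw [this]; ring
  exact hsum.congr_deriv e

/-- `m′(t) = log(4t(1+t)/(1+2t)²) ≤ 0`. -/
theorem cwGasEnvelope_deriv_nonpos {t : ℝ} (ht : 0 < t) :
    2 * Real.log 2 - 2 * Real.log (1 + 2 * t) + Real.log (1 + t) + Real.log t ≤ 0 := by
  have h12 : 0 < 1 + 2 * t := by linarith
  have h1 : 0 < 1 + t := by linarith
  have e : 2 * Real.log 2 - 2 * Real.log (1 + 2 * t) + Real.log (1 + t) + Real.log t =
      Real.log (2 ^ 2 * (t * (1 + t))) - Real.log ((1 + 2 * t) ^ 2) := by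
    rw [Real.log_mul (by positivity) (by positivity), Real.log_pow, Real.log_mul ht.ne' h1.ne',
      Real.log_pow]
    push_cast
    ring
  rw [e, sub_nonpos, Real.log_le_log_iff (by positivity) (by positivity)]
  nlinarith

/-- The envelope is continuous on every subset of `[0, ∞)`. -/
theorem cwGasEnvelope_continuousOn (s : Set ℝ) (hs : s ⊆ Set.Ici 0) : ContinuousOn cwGasEnvelope s := by
  intro t ht
  have ht0 : 0 ≤ t := hs ht
  have h12 : (1 + 2 * t) ≠ 0 := by linarith
  apply ContinuousAt.continuousWithinAt
  have hA : ContinuousAt (fun t : ℝ => 1 + 2 * t) t := by fun_prop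
  have hlog : ContinuousAt (fun t : ℝ => Real.log (1 + 2 * t)) t := hA.log h12
  have hD : ContinuousAt (fun t : ℝ => (1 + t) * Real.log (1 + t)) t :=
    (Real.continuous_mul_log.comp (continuous_const.add continuous_id)).continuousAt
  have hE : ContinuousAt (fun t : ℝ => t * Real.log t) t := Real.continuous_mul_log.continuousAt
  exact ((hA.mul (continuousAt_const.sub hlog)).add hD).add hE

/-- The envelope is antitone on all of `[0, ∞)` (below the balance it is the first-power functional; above it, the
Y-count functional of the x-shared star configuration, which therefore tends to its infimum `0` as `t → ∞`). -/
theorem cwGasEnvelope_antitoneOn_Ici : AntitoneOn cwGasEnvelope (Set.Ici 0) := by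
  apply antitoneOn_of_deriv_nonpos (convex_Ici (0 : ℝ)) (cwGasEnvelope_continuousOn _ le_rfl)
  · intro t ht
    rw [interior_Ici] at ht
    exact (cwGasEnvelope_hasDerivAt ht).differentiableAt.differentiableWithinAt
  · intro t ht
    rw [interior_Ici] at ht
    rw [(cwGasEnvelope_hasDerivAt ht).deriv]
    exact cwGasEnvelope_deriv_nonpos ht

/-- The envelope is antitone on the feasible strip `[0, ½]`. -/
theorem cwGasEnvelope_antitoneOn : AntitoneOn cwGasEnvelope (Set.Icc 0 (1 / 2)) :=
  cwGasEnvelope_antitoneOn_Ici.mono fun _ ht => ht.1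

/-- Below the X/Y balance the envelope stays above `c₁`. -/
theorem cwFarEdgeConstant_le_cwGasEnvelope {t : ℝ} (ht0 : 0 ≤ t) (ht : t ≤ 1 / 2) :
    cwFarEdgeConstant ≤ cwGasEnvelope t := by
  rw [← cwGasEnvelope_half]
  exact cwGasEnvelope_antitoneOn_Ici (Set.mem_Ici.mpr ht0) (Set.mem_Ici.mpr (by norm_num)) ht

/-- Above the balance the envelope drops BELOW `c₁` (this is the Y-count value an x-shared star harvest would reach). -/
theorem cwGasEnvelope_le_cwFarEdgeConstant {t : ℝ} (ht : 1 / 2 ≤ t) :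
    cwGasEnvelope t ≤ cwFarEdgeConstant := by
  rw [← cwGasEnvelope_half]
  exact cwGasEnvelope_antitoneOn_Ici (Set.mem_Ici.mpr (by norm_num))
    (Set.mem_Ici.mpr (le_trans (by norm_num) ht)) ht

/-- **The dilute first-power functional never goes below `c₁` on the feasible strip.** -/
theorem cwFarEdgeConstant_le_cwGas {c t : ℝ} (hc : 0 < c) (ht0 : 0 ≤ t) (ht : t ≤ 1 / 2) :
    cwFarEdgeConstant ≤ cwGas c t :=
  (cwFarEdgeConstant_le_cwGasEnvelope ht0 ht).trans (cwGasEnvelope_le_cwGas hc ht0)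

/-! ## CoupledGas — the power-`m` kernel inequality `N(w,h) ≥ c₁ (1+h)` -/

/-- The coupled functional of the power-`m` programme after the zero-price classification:
`N(w,h) = (1+2w+h)·(log 2 − log(1+2w+h)) + (1+w+h)·log(1+w+h) + w·log w`
(`w` = scalar/`A±` rate, `h` = relative mass of the type `C = (2,m−1,m−1)`; `N(w,0) = cwGasEnvelope w`). -/
def cwGasCouple (w h : ℝ) : ℝ :=
  (1 + 2 * w + h) * (Real.log 2 - Real.log (1 + 2 * w + h)) + (1 + w + h) * Real.log (1 + w + h)
    + w * Real.log w

/-- `N(w,0) = m(w)`: the coupled functional extends the envelope. -/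
theorem cwGasCouple_zero (w : ℝ) : cwGasCouple w 0 = cwGasEnvelope w := by
  unfold cwGasCouple cwGasEnvelope
  simp

/-- `∂_h N(w,h) = log 2 − log(1+2w+h) + log(1+w+h)`. -/
theorem cwGasCouple_hasDerivAt {w h : ℝ} (hw : 0 ≤ w) (hh : -1 < h) :
    HasDerivAt (fun h : ℝ => cwGasCouple w h)
      (Real.log 2 - Real.log (1 + 2 * w + h) + Real.log (1 + w + h)) h := by
  have h12 : 0 < 1 + 2 * w + h := by linarith
  have h1 : 0 < 1 + w + h := by linarith
  have hA : HasDerivAt (fun h : ℝ => 1 + 2 * w + h) 1 h := by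
    simpa using (hasDerivAt_id h).const_add (1 + 2 * w : ℝ)
  have hB : HasDerivAt (fun h : ℝ => Real.log (1 + 2 * w + h)) (1 / (1 + 2 * w + h)) h := hA.log h12.ne'
  have hC : HasDerivAt (fun h : ℝ => (1 + 2 * w + h) * (Real.log 2 - Real.log (1 + 2 * w + h)))
      (1 * (Real.log 2 - Real.log (1 + 2 * w + h)) + (1 + 2 * w + h) * (0 - 1 / (1 + 2 * w + h))) h :=
    hA.mul ((hasDerivAt_const h (Real.log 2)).sub hB)
  have hS : HasDerivAt (fun h : ℝ => 1 + w + h) 1 h := by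
    simpa using (hasDerivAt_id h).const_add (1 + w : ℝ)
  have hD : HasDerivAt (fun h : ℝ => (1 + w + h) * Real.log (1 + w + h)) ((Real.log (1 + w + h) + 1) * 1) h :=
    (Real.hasDerivAt_mul_log h1.ne').comp h hS
  have hE : HasDerivAt (fun _ : ℝ => w * Real.log w) 0 h := hasDerivAt_const h _
  have hsum := (hC.add hD).add hE
  have e3 : (1 + 2 * w + h) * (1 / (1 + 2 * w + h)) = 1 := by field_simp
  have e : 1 * (Real.log 2 - Real.log (1 + 2 * w + h)) + (1 + 2 * w + h) * (0 - 1 / (1 + 2 * w + h)) +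
      (Real.log (1 + w + h) + 1) * 1 + 0 =
      Real.log 2 - Real.log (1 + 2 * w + h) + Real.log (1 + w + h) := by
    have : (1 + 2 * w + h) * (0 - 1 / (1 + 2 * w + h)) = -1 := by rw [zero_sub, mul_neg, e3]
    rw [this]; ring
  exact hsum.congr_deriv e

/-- The `h`-slope is at least `log(3/2)` as soon as `2w ≤ 1 + h` (in particular for `w ≤ ½`, `h ≥ 0`):
`log(2(1+w+h)/(1+2w+h)) ≥ log(3/2) ⟺ 4(1+w+h) ≥ 3(1+2w+h) ⟺ 1 + h ≥ 2w`. -/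
theorem cwGasCouple_deriv_ge {w h : ℝ} (hw : 0 ≤ w) (hh : -1 < h) (hwh : 2 * w ≤ 1 + h) :
    Real.log (3 / 2) ≤ Real.log 2 - Real.log (1 + 2 * w + h) + Real.log (1 + w + h) := by
  have h12 : 0 < 1 + 2 * w + h := by linarith
  have h1 : 0 < 1 + w + h := by linarith
  have e : Real.log 2 - Real.log (1 + 2 * w + h) + Real.log (1 + w + h) =
      Real.log (2 * (1 + w + h) / (1 + 2 * w + h)) := by
    rw [Real.log_div (by positivity) h12.ne', Real.log_mul two_ne_zero h1.ne']
    ring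
  rw [e, Real.log_le_log_iff (by norm_num) (by positivity), le_div_iff₀ h12]
  linarith

/-- `h ↦ N(w,h)` is continuous on `[0, ∞)`. -/
theorem cwGasCouple_continuousOn {w : ℝ} (hw : 0 ≤ w) : ContinuousOn (fun h : ℝ => cwGasCouple w h) (Set.Ici 0) :=
  fun h hh => (cwGasCouple_hasDerivAt hw (by
    have : (0:ℝ) ≤ h := hh
    linarith)).continuousAt.continuousWithinAt

/-- `h ↦ N(w,h) − h·log(3/2)` is monotone on `[0, ∞)` for `w ∈ [0, ½]`. -/
theorem cwGasCouple_sub_monotoneOn {w : ℝ} (hw : 0 ≤ w) (hw2 : w ≤ 1 / 2) :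
    MonotoneOn (fun h : ℝ => cwGasCouple w h - h * Real.log (3 / 2)) (Set.Ici 0) := by
  have hcont : ContinuousOn (fun h : ℝ => cwGasCouple w h - h * Real.log (3 / 2)) (Set.Ici 0) :=
    (cwGasCouple_continuousOn hw).sub (by fun_prop)
  apply monotoneOn_of_deriv_nonneg (convex_Ici (0 : ℝ)) hcont
  · intro h hh
    rw [interior_Ici] at hh
    have hh' : (-1 : ℝ) < h := by
      have : (0:ℝ) < h := hh
      linarith
    have hd : HasDerivAt (fun h : ℝ => cwGasCouple w h - h * Real.log (3 / 2))
        (Real.log 2 - Real.log (1 + 2 * w + h) + Real.log (1 + w + h) - 1 * Real.log (3 / 2)) h :=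
      (cwGasCouple_hasDerivAt hw hh').sub ((hasDerivAt_id h).mul_const (Real.log (3 / 2)))
    exact hd.differentiableAt.differentiableWithinAt
  · intro h hh
    rw [interior_Ici] at hh
    have h0 : (0 : ℝ) < h := hh
    have hh' : (-1 : ℝ) < h := by linarith
    have hd : HasDerivAt (fun h : ℝ => cwGasCouple w h - h * Real.log (3 / 2))
        (Real.log 2 - Real.log (1 + 2 * w + h) + Real.log (1 + w + h) - 1 * Real.log (3 / 2)) h :=
      (cwGasCouple_hasDerivAt hw hh').sub ((hasDerivAt_id h).mul_const (Real.log (3 / 2)))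
    rw [hd.deriv]
    have := cwGasCouple_deriv_ge hw hh' (by linarith)
    linarith

/-- `N(w,h) ≥ N(w,0) + h·log(3/2)` for `w ∈ [0,½]`, `h ≥ 0`. -/
theorem cwGasCouple_ge_tangent {w h : ℝ} (hw : 0 ≤ w) (hw2 : w ≤ 1 / 2) (hh : 0 ≤ h) :
    cwGasEnvelope w + h * Real.log (3 / 2) ≤ cwGasCouple w h := by
  have hm := cwGasCouple_sub_monotoneOn hw hw2 (Set.mem_Ici.mpr le_rfl) (Set.mem_Ici.mpr hh) hh
  simp only [zero_mul, sub_zero, cwGasCouple_zero] at hm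
  linarith

/-- **Power-`m` kernel inequality** `(★)`: `c₁ · (1 + h) ≤ N(w,h)` on `w ∈ [0,½]`, `h ≥ 0`, with equality only at
`(w,h) = (½,0)`.  With the per-block flattening caps `Γ_B ≤ log m`, `γ_C ≤ log m` this is `F_m ≥ c₁`: the type `C` and
the higher-power blocks `B, B′` cannot move the far-edge constant (NODE-v15 §2). -/
theorem cwFarEdgeConstant_mul_le_cwGasCouple {w h : ℝ} (hw : 0 ≤ w) (hw2 : w ≤ 1 / 2) (hh : 0 ≤ h) :
    cwFarEdgeConstant * (1 + h) ≤ cwGasCouple w h := by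
  have h1 := cwGasCouple_ge_tangent hw hw2 hh
  have h2 := cwFarEdgeConstant_le_cwGasEnvelope hw hw2
  have h3 : h * cwFarEdgeConstant ≤ h * Real.log (3 / 2) :=
    mul_le_mul_of_nonneg_left cwFarEdgeConstant_lt_log_three_halves.le hh
  nlinarith

/-- The same inequality with the explicit constant, in the shape used by the informal reduction:
`(3/2·log 3 − 2·log 2)·(1+h) + (1+h)·log m − log m − h·log m ≤ N(w,h) + …`, i.e. after dividing by `1+h`
the power-`m` functional is `≥ c₁` whatever the admissible caps `Γ_B, γ_C ≤ log m`. -/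
theorem powerFunctional_ge {w h ΓB γC Lm : ℝ} (hw : 0 ≤ w) (hw2 : w ≤ 1 / 2) (hh : 0 ≤ h)
    (hB : ΓB ≤ Lm) (hC : γC ≤ Lm) :
    (3 / 2 * Real.log 3 - 2 * Real.log 2) * (1 + h) ≤ cwGasCouple w h + (1 + h) * Lm - ΓB - h * γC := by
  have h1 := cwFarEdgeConstant_mul_le_cwGasCouple hw hw2 hh
  rw [cwFarEdgeConstant_def] at h1
  nlinarith

/-! ## ZeroPrice — arithmetic of the survivor classification at power `m` -/

/-- Folded level `λ(U) = min(U, 2m − U)` of a level-`U` block of `CW_q^{⊗m}` (`0 ≤ U ≤ 2m`); the block's largest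
flattening rank is `≍ q^{λ(U)}` (times `m`-dependent constants), full (`≍ q^m`) only at `U = m`. -/
def foldedLevel (m U : ℕ) : ℕ := min U (2 * m - U)

/-- Leading-order Y/Z-side price of a level in units of `L = log(1/β)`: `m − λ(U) − [U ≠ m]` (the `−1` is the one unit
of count entropy a non-bulk level buys). -/
def levelPrice (m U : ℕ) : ℕ := m - foldedLevel m U - (if U = m then 0 else 1)

/-- `λ(U) ≤ m`. -/
theorem foldedLevel_le (m U : ℕ) : foldedLevel m U ≤ m := by
  unfold foldedLevel; omega

/-- `λ(U) = m` iff `U` is the bulk level `m`. -/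
theorem foldedLevel_eq_iff (m U : ℕ) (hU : U ≤ 2 * m) : foldedLevel m U = m ↔ U = m := by
  unfold foldedLevel; omega

/-- Off the bulk level the folded level is at most `m − 1`. -/
theorem foldedLevel_succ_le (m U : ℕ) (hne : U ≠ m) : foldedLevel m U + 1 ≤ m ∨ m = 0 := by
  unfold foldedLevel; omega

/-- A level has price zero iff it is within one of the bulk level: `U ∈ {m−1, m, m+1}`. -/
theorem levelPrice_eq_zero_iff (m U : ℕ) (hU : U ≤ 2 * m) :
    levelPrice m U = 0 ↔ (m ≤ U + 1 ∧ U ≤ m + 1) := by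
  unfold levelPrice foldedLevel
  split_ifs with h <;> omega

/-- **Zero-price survivors.**  The level triples `(I,J,K)` with `I + J + K = 2m` whose `J`- and `K`-prices vanish are
exactly: bulk `(0,m,m)`, `A⁻ = (0,m−1,m+1)`, `A⁺ = (0,m+1,m−1)`, `B = (1,m−1,m)`, `B′ = (1,m,m−1)`,
`C = (2,m−1,m−1)`; in particular `I ≤ 2` is forced (the far edge only ever uses x-levels `0,1,2`). -/
theorem zeroPrice_classification (m I J K : ℕ) (hm : 1 ≤ m) (hsum : I + J + K = 2 * m)
    (hJ : levelPrice m J = 0) (hK : levelPrice m K = 0) :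
    (I = 0 ∧ J = m ∧ K = m) ∨ (I = 0 ∧ J = m - 1 ∧ K = m + 1) ∨ (I = 0 ∧ J = m + 1 ∧ K = m - 1) ∨
      (I = 1 ∧ J = m - 1 ∧ K = m) ∨ (I = 1 ∧ J = m ∧ K = m - 1) ∨ (I = 2 ∧ J = m - 1 ∧ K = m - 1) := by
  have hJ2 : J ≤ 2 * m := by omega
  have hK2 : K ≤ 2 * m := by omega
  rw [levelPrice_eq_zero_iff m J hJ2] at hJ
  rw [levelPrice_eq_zero_iff m K hK2] at hK
  omega

/-- Conversely each of the six types has zero `J`- and `K`-price (for `m ≥ 1`). -/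
theorem zeroPrice_survivors (m : ℕ) (hm : 1 ≤ m) :
    levelPrice m m = 0 ∧ levelPrice m (m - 1) = 0 ∧ levelPrice m (m + 1) = 0 := by
  refine ⟨?_, ?_, ?_⟩ <;> (rw [levelPrice_eq_zero_iff] <;> omega)

/-- Every other level costs at least one unit of `L`: positive price off `{m−1,m,m+1}`. -/
theorem levelPrice_pos (m U : ℕ) (hU : U ≤ 2 * m) (hfar : U + 2 ≤ m ∨ m + 2 ≤ U) : 1 ≤ levelPrice m U := by
  have h := (levelPrice_eq_zero_iff m U hU).not
  omega

end Summit.MatrixMultiplication.MatrixMultiplication.Theorems.FarEdgeDescentFarEdgeRigidity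

end
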